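import Mathlib
import Summits.AnomalousDissipation.AnomalousDissipation.Theorems.LaminarNeverLoud.Negative.PowerBudget

/-!
# Tier A of the stub plan for `stub_loudCoatDecades` (line `idea-sketch-ideator2`, card `euler-core-coat-readout`),
# crux stmt-AnomalousDissipation-2986 (`MirrorVariety.GalerkinSteadyZerothLaw`): tube / path topology and N–K uniqueness

`STUB-PLAN-stub_loudCoatDecades.md` §2.2 tier A (k3-H1/H2/H3, k2-H1).  Pure topology / elementary analysis, the
degree-free continuation tools with which one decade of the force-coordinate heart (`stub_steadyTubeLadder`: a
CONNECTED set of Galerkin steady states of a fixed force whose viscosities cover an interval) is assembled from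
pointwise Newton–Kantorovich data:

* `isConnected_of_isCompact_injOn_fst` (A1): a compact set over `[a, b]` with single-valued fibres is connected —
  `fst|_Z : Z → Icc a b` is a continuous bijection from a compact space onto a T₂ space, hence a homeomorphism
  (`Continuous.homeoOfEquivCompactToT2`), and `Icc a b` is connected;
* `coatSet_of_path` (A2): the image of a continuous path is connected and its first coordinates cover every
  interval between the endpoints' first coordinates (fold-tolerant packaging of pseudo-arclength continuation);
* `steadyTube_connected` (A3): existence within `R` of a continuous centre curve `v` on `[a, b]` plus uniqueness
  within `R` ⇒ the tube of zeros `{(t, c) | t ∈ [a, b], G (t, c) = 0, ‖c - v t‖ ≤ R}` is connected and projects ONTO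
  `[a, b]` (closed and bounded in finite dimension ⇒ compact; `fst`-injective by uniqueness; A1) — no continuity of
  the selected branch is needed as an input;
* `zero_unique_of_infSup_lipschitz` (A4): the uniqueness half of the inf-sup Newton–Kantorovich theorem
  (`Literature.Analysis.Calculus.exists_zero_of_infSup_newton`, same data): two zeros within `r` of the centre
  coincide once `2β|M|r < 1`.

The closing `stub_loudCoatTubeTools` is the REGISTERED conjunction (A1–A4 specialised to the coefficient space
`↥(modes (Fin 3) N) → EuclideanSpace ℂ (Fin 3)` of the crux).  References: Brezzi–Rappaz–Raviart, *Numer. Math.* 36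
(1980) Thm. 3; Magnus 2022 Prop. 6.7 (as cited by `NewtonKantorovichInfSup.lean`); Mathlib.
-/

noncomputable section

-- `Summit.<Summit>.<Problem>` is the tree's mandated summit-side namespace (CONVENTIONS §2); deliberate duplicate.
set_option linter.dupNamespace false

open Set Metric Filter Topology

namespace Summit.AnomalousDissipation.AnomalousDissipation.Theorems.GalerkinSteadyZerothLaw

open Summit.AnomalousDissipation.AnomalousDissipation.Theorems.LaminarNeverLoud.Negative (modes)

/-- **A1 `isConnected_of_isCompact_injOn_fst`** (pure topology).  A compact set `Z ⊆ ℝ × X` (`X` Hausdorff) whose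
first projection is a bijection onto `[a, b]`, `a ≤ b`, is connected: the projection `Z → Icc a b` is a continuous
bijection from a compact space to a T₂ space, hence a homeomorphism, and `Icc a b` is connected. [folklore] -/
theorem isConnected_of_isCompact_injOn_fst {X : Type*} [TopologicalSpace X] [T2Space X]
    {Z : Set (ℝ × X)} {a b : ℝ} (hab : a ≤ b) (hZ : IsCompact Z)
    (himg : Prod.fst '' Z = Icc a b) (hinj : InjOn Prod.fst Z) : IsConnected Z := by
  haveI : CompactSpace Z := isCompact_iff_compactSpace.1 hZ
  -- the restriction of `fst` to `Z`, with values in `Icc a b`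
  have hmem : ∀ z : Z, (z : ℝ × X).1 ∈ Icc a b := fun z => himg ▸ mem_image_of_mem Prod.fst z.2
  let f : Z → Icc a b := fun z => ⟨(z : ℝ × X).1, hmem z⟩
  have hf : Continuous f := (continuous_fst.comp continuous_subtype_val).subtype_mk _
  have hbij : Function.Bijective f := by
    refine ⟨fun z z' h => Subtype.ext (hinj z.2 z'.2 (congrArg Subtype.val h)), fun t => ?_⟩
    have ht : (t : ℝ) ∈ Prod.fst '' Z := himg.symm ▸ t.2
    obtain ⟨z, hz, hzt⟩ := ht
    exact ⟨⟨z, hz⟩, Subtype.ext hzt⟩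
  let e : Z ≃ₜ Icc a b := Continuous.homeoOfEquivCompactToT2 (f := Equiv.ofBijective f hbij) hf
  haveI : ConnectedSpace (Icc a b) := isConnected_iff_connectedSpace.1 (isConnected_Icc hab)
  haveI : ConnectedSpace Z := e.symm.surjective.connectedSpace e.symm.continuous
  exact isConnected_iff_connectedSpace.2 ‹ConnectedSpace Z›

/-- **A2 `coatSet_of_path`** (pure topology; fold-tolerant packaging of a continued branch).  The image of a
continuous path `γ : [0, 1] → ℝ × X` is connected, and its first coordinates cover every interval `[a, b]` with
`(γ 0).1 ≤ a`, `b ≤ (γ 1).1` (intermediate value theorem for `fst ∘ γ`). [folklore] -/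
theorem coatSet_of_path {X : Type*} [TopologicalSpace X] (γ : ℝ → ℝ × X)
    (hγ : ContinuousOn γ (Icc (0 : ℝ) 1)) {a b : ℝ} (ha : (γ 0).1 ≤ a) (hb : b ≤ (γ 1).1) :
    IsConnected (γ '' Icc (0 : ℝ) 1) ∧ Icc a b ⊆ Prod.fst '' (γ '' Icc (0 : ℝ) 1) := by
  refine ⟨(isConnected_Icc zero_le_one).image γ hγ, ?_⟩
  rw [Set.image_image]
  have hcont : ContinuousOn (fun t => (γ t).1) (Icc (0 : ℝ) 1) := continuous_fst.comp_continuousOn hγ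
  exact (Icc_subset_Icc ha hb).trans (intermediate_value_Icc zero_le_one hcont)

/-- **A3 `steadyTube_connected`** (degree-free continuation in a tube).  Let `G : ℝ × X → Y` be continuous (`X`
finite-dimensional), `v` a centre curve continuous on `[a, b]`, `a ≤ b`, and suppose that for every `t ∈ [a, b]`
the equation `G (t, c) = 0` has a solution with `‖c - v t‖ ≤ R` and at most one such solution.  Then the tube of
zeros `{(t, c) | t ∈ [a, b], G (t, c) = 0, ‖c - v t‖ ≤ R}` is CONNECTED and its first projection is `[a, b]`
(it is closed and bounded, hence compact; the projection is injective by uniqueness and onto by existence; A1).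
[folklore] -/
theorem steadyTube_connected {X : Type*} [NormedAddCommGroup X] [NormedSpace ℝ X] [FiniteDimensional ℝ X]
    {Y : Type*} [NormedAddCommGroup Y] (G : ℝ × X → Y) (hG : Continuous G) (v : ℝ → X) {a b R : ℝ}
    (hab : a ≤ b) (hv : ContinuousOn v (Icc a b))
    (hex : ∀ t ∈ Icc a b, ∃ c, G (t, c) = 0 ∧ ‖c - v t‖ ≤ R)
    (huniq : ∀ t ∈ Icc a b, ∀ c c', G (t, c) = 0 → G (t, c') = 0 → ‖c - v t‖ ≤ R → ‖c' - v t‖ ≤ R → c = c') :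
    IsConnected {p : ℝ × X | p.1 ∈ Icc a b ∧ G p = 0 ∧ ‖p.2 - v p.1‖ ≤ R} ∧
      Prod.fst '' {p : ℝ × X | p.1 ∈ Icc a b ∧ G p = 0 ∧ ‖p.2 - v p.1‖ ≤ R} = Icc a b := by
  set T := {p : ℝ × X | p.1 ∈ Icc a b ∧ G p = 0 ∧ ‖p.2 - v p.1‖ ≤ R} with hT
  -- the projection is onto `[a, b]` (existence)
  have himg : Prod.fst '' T = Icc a b := by
    refine Subset.antisymm ?_ ?_
    · rintro _ ⟨p, hp, rfl⟩
      exact hp.1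
    · intro t ht
      obtain ⟨c, hc, hcR⟩ := hex t ht
      exact ⟨(t, c), ⟨ht, hc, hcR⟩, rfl⟩
  -- the projection is injective on `T` (uniqueness)
  have hinj : InjOn Prod.fst T := by
    rintro ⟨t, c⟩ ⟨ht, hc, hcR⟩ ⟨t', c'⟩ ⟨-, hc', hc'R⟩ htt'
    simp only at ht hc hcR hc' hc'R htt'
    subst htt'
    exact Prod.ext rfl (huniq t ht c c' hc hc' hcR hc'R)
  -- `T` is closed: on the closed strip `Icc a b ×ˢ univ` the conditions are closed conditions
  have hS : IsClosed ((Icc a b) ×ˢ (univ : Set X)) := isClosed_Icc.prod isClosed_univ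
  have hdist : ContinuousOn (fun p : ℝ × X => ‖p.2 - v p.1‖) ((Icc a b) ×ˢ (univ : Set X)) := by
    refine (continuous_snd.continuousOn.sub ?_).norm
    exact hv.comp continuous_fst.continuousOn fun p hp => hp.1
  have hT_eq : T = ((Icc a b) ×ˢ (univ : Set X)) ∩ (G ⁻¹' {0}) ∩
      (((Icc a b) ×ˢ (univ : Set X)) ∩ (fun p : ℝ × X => ‖p.2 - v p.1‖) ⁻¹' (Iic R)) := by
    ext p
    simp only [hT, mem_setOf_eq, mem_inter_iff, mem_prod, mem_univ, and_true, mem_preimage, mem_singleton_iff,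
      mem_Iic]
    tauto
  have hclosed : IsClosed T := by
    rw [hT_eq]
    exact (hS.inter (isClosed_singleton.preimage hG)).inter (hdist.preimage_isClosed_of_isClosed hS isClosed_Iic)
  -- `T` is bounded: inside the compact `Icc a b ×ˢ closedBall 0 (M + R)`
  obtain ⟨M, hM⟩ := isCompact_Icc.exists_bound_of_continuousOn hv
  have hsub : T ⊆ (Icc a b) ×ˢ closedBall (0 : X) (M + R) := by
    rintro ⟨t, c⟩ ⟨ht, -, hcR⟩
    simp only at ht hcR
    refine ⟨ht, ?_⟩
    rw [mem_closedBall, dist_zero_right]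
    calc ‖c‖ = ‖(c - v t) + v t‖ := by rw [sub_add_cancel]
      _ ≤ ‖c - v t‖ + ‖v t‖ := norm_add_le _ _
      _ ≤ R + M := add_le_add hcR (hM t ht)
      _ = M + R := add_comm _ _
  have hcpt : IsCompact T :=
    (isCompact_Icc.prod (isCompact_closedBall (0 : X) (M + R))).of_isClosed_subset hclosed hsub
  exact ⟨isConnected_of_isCompact_injOn_fst hab hcpt himg hinj, himg⟩

/-- **A4 `zero_unique_of_infSup_lipschitz`** (the uniqueness half of the inf-sup Newton–Kantorovich theorem, same
data as `Literature.Analysis.Calculus.exists_zero_of_infSup_newton`).  If the tested residual `Φ` has the centred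
Lipschitz bound `|Φ x a - Φ y a - Λ (x - y) a| ≤ β (‖x - v‖ + ‖y - v‖) ‖x - y‖ ‖a‖` against a tested linear part
`Λ` with inf-sup constant `M` (`‖w‖ ‖a_w‖ ≤ M Λ w a_w` for a suitable nonzero test vector `a_w`), then two zeros of
`Φ` within `r` of `v` coincide once `2β|M|r < 1` (test the difference `x - y`). [folklore] -/
theorem zero_unique_of_infSup_lipschitz {T : Type*} [NormedAddCommGroup T] [NormedSpace ℝ T]
    {Φ : T → T → ℝ} {Λ : T → T → ℝ} {v : T} {β M r : ℝ} (hβ : 0 ≤ β)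
    (hlip : ∀ x y a, |Φ x a - Φ y a - Λ (x - y) a| ≤ β * (‖x - v‖ + ‖y - v‖) * ‖x - y‖ * ‖a‖)
    (hinf : ∀ w, ∃ a, ‖w‖ * ‖a‖ ≤ M * Λ w a ∧ (0 < ‖w‖ → 0 < ‖a‖))
    {x y : T} (hx : ∀ a, Φ x a = 0) (hy : ∀ a, Φ y a = 0)
    (hxr : ‖x - v‖ ≤ r) (hyr : ‖y - v‖ ≤ r) (hsmall : 2 * β * |M| * r < 1) : x = y := by
  by_contra hne
  have hw : 0 < ‖x - y‖ := norm_pos_iff.2 (sub_ne_zero.2 hne)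
  obtain ⟨a, ha, ha'⟩ := hinf (x - y)
  have hapos : 0 < ‖a‖ := ha' hw
  have h1 : |Λ (x - y) a| ≤ β * (‖x - v‖ + ‖y - v‖) * ‖x - y‖ * ‖a‖ := by
    have h := hlip x y a
    rwa [hx a, hy a, sub_zero, zero_sub, abs_neg] at h
  have h2 : M * Λ (x - y) a ≤ |M| * (β * (‖x - v‖ + ‖y - v‖) * ‖x - y‖ * ‖a‖) := by
    refine (le_abs_self _).trans ?_
    rw [abs_mul]
    exact mul_le_mul_of_nonneg_left h1 (abs_nonneg M)
  have h3 : ‖x - v‖ + ‖y - v‖ ≤ 2 * r := by linarith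
  have h4 : β * (‖x - v‖ + ‖y - v‖) * ‖x - y‖ * ‖a‖ ≤ β * (2 * r) * ‖x - y‖ * ‖a‖ :=
    mul_le_mul_of_nonneg_right (mul_le_mul_of_nonneg_right (mul_le_mul_of_nonneg_left h3 hβ) (norm_nonneg _))
      (norm_nonneg _)
  have hP : 0 < ‖x - y‖ * ‖a‖ := mul_pos hw hapos
  have h5 : ‖x - y‖ * ‖a‖ ≤ (2 * β * |M| * r) * (‖x - y‖ * ‖a‖) :=
    calc ‖x - y‖ * ‖a‖ ≤ M * Λ (x - y) a := ha
      _ ≤ |M| * (β * (‖x - v‖ + ‖y - v‖) * ‖x - y‖ * ‖a‖) := h2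
      _ ≤ |M| * (β * (2 * r) * ‖x - y‖ * ‖a‖) := mul_le_mul_of_nonneg_left h4 (abs_nonneg M)
      _ = (2 * β * |M| * r) * (‖x - y‖ * ‖a‖) := by ring
  have h6 : 1 ≤ 2 * β * |M| * r := (le_mul_iff_one_le_left hP).1 h5
  linarith

/-- **stub_loudCoatTubeTools** (REGISTERED sub-goal of the line `idea-sketch-ideator2`: tier A of the stub plan for
`stub_loudCoatDecades`).  The conjunction of A1 `isConnected_of_isCompact_injOn_fst`, A2 `coatSet_of_path`,
A3 `steadyTube_connected`, A4 `zero_unique_of_infSup_lipschitz`, specialised to the coefficient space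
`↥(modes (Fin 3) N) → EuclideanSpace ℂ (Fin 3)` of the crux. [folklore] -/
theorem stub_loudCoatTubeTools : (∀ (N : ℕ) (Z : Set (ℝ × (↥(modes (Fin 3) N) → EuclideanSpace ℂ (Fin 3)))) (a b : ℝ), a ≤ b → IsCompact Z → Prod.fst '' Z = Set.Icc a b → Set.InjOn Prod.fst Z → IsConnected Z) ∧ (∀ (N : ℕ) (γ : ℝ → ℝ × (↥(modes (Fin 3) N) → EuclideanSpace ℂ (Fin 3))) (a b : ℝ), ContinuousOn γ (Set.Icc (0 : ℝ) 1) → (γ 0).1 ≤ a → b ≤ (γ 1).1 → IsConnected (γ '' Set.Icc (0 : ℝ) 1) ∧ Set.Icc a b ⊆ Prod.fst '' (γ '' Set.Icc (0 : ℝ) 1)) ∧ (∀ (N : ℕ) (G : ℝ × (↥(modes (Fin 3) N) → EuclideanSpace ℂ (Fin 3)) → (↥(modes (Fin 3) N) → EuclideanSpace ℂ (Fin 3))) (v : ℝ → (↥(modes (Fin 3) N) → EuclideanSpace ℂ (Fin 3))) (a b R : ℝ), Continuous G → a ≤ b → ContinuousOn v (Set.Icc a b) → (∀ t ∈ Set.Icc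 a b, ∃ c, G (t, c) = 0 ∧ ‖c - v t‖ ≤ R) → (∀ t ∈ Set.Icc a b, ∀ c c', G (t, c) = 0 → G (t, c') = 0 → ‖c - v t‖ ≤ R → ‖c' - v t‖ ≤ R → c = c') → IsConnected {p : ℝ × (↥(modes (Fin 3) N) → EuclideanSpace ℂ (Fin 3)) | p.1 ∈ Set.Icc a b ∧ G p = 0 ∧ ‖p.2 - v p.1‖ ≤ R} ∧ Prod.fst '' {p : ℝ × (↥(modes (Fin 3) N) → EuclideanSpace ℂ (Fin 3)) | p.1 ∈ Set.Icc a b ∧ G p = 0 ∧ ‖p.2 - v p.1‖ ≤ R} = Set.Icc a b) ∧ (∀ (N : ℕ) (Φ Λ : (↥(modes (Fin 3) N) → EuclideanSpace ℂ (Fin 3)) → (↥(modes (Fin 3) N) → EuclideanSpace ℂ (Fin 3)) → ℝ) (v : ↥(modes (Fin 3) N) → EuclideanSpace ℂ (Fin 3)) (β M r : ℝ) (x y : ↥(modes (Fin 3) N) → EuclideanSpace ℂ (Fin 3)), 0 ≤ β → (∀ x y a, |Φ x a - Φ y a - Λ (x - y) a| ≤ β * (‖x - v‖ + ‖y - v‖)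 * ‖x - y‖ * ‖a‖) → (∀ w, ∃ a, ‖w‖ * ‖a‖ ≤ M * Λ w a ∧ (0 < ‖w‖ → 0 < ‖a‖)) → (∀ a, Φ x a = 0) → (∀ a, Φ y a = 0) → ‖x - v‖ ≤ r → ‖y - v‖ ≤ r → 2 * β * |M| * r < 1 → x = y) :=
  ⟨fun _ _ _ _ hab hZ himg hinj => isConnected_of_isCompact_injOn_fst hab hZ himg hinj,
    fun _ γ _ _ hγ ha hb => coatSet_of_path γ hγ ha hb,
    fun _ G v _ _ _ hG hab hv hex huniq => steadyTube_connected G hG v hab hv hex huniq,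
    fun _ _ _ _ _ _ _ _ _ hβ hlip hinf hx hy hxr hyr hsmall =>
      zero_unique_of_infSup_lipschitz hβ hlip hinf hx hy hxr hyr hsmall⟩

end Summit.AnomalousDissipation.AnomalousDissipation.Theorems.GalerkinSteadyZerothLaw

end
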